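import Mathlib
import Literature.RepresentationTheory.FiniteGroups.KLRGradedCellularBasis
import Literature.RepresentationTheory.FiniteGroups.VershikKerovMaxDegreeProofs

/-!
# `#TableauPair n = n!` — the index set of the Hu–Mathas basis has `n!` elements

Line `klr-graded-polynomial-method` of crux `SnSubsetDichotomy.NoThresholdSubsetTriple` (stmt-MatrixMultiplication-8302),
infrastructure for the open stub `stub_degreeTailSingle` (its trivial bound, and the normalisation of every tail count):
`Nat.card (TableauPair n) = ∑_{μ ⊢ n} (f^μ)² = n!`, from the tree theorems `sum_sq_numStandardTableaux` (Burnside /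
Robinson–Schensted count, proved in the tree through the character theory of `S_n`) and
`numStandardTableaux_eq_card_stdFilling`.
-/

namespace Summit.MatrixMultiplication.MatrixMultiplication.Theorems

open Literature.RepresentationTheory.FiniteGroups (TableauPair)
open Literature.NumberTheory.DiophantineGeometry (StdFilling numStandardTableaux numStandardTableaux_eq_card_stdFilling)

set_option linter.dupNamespace false in -- deliberate Summit.<S>.<P> duplicate
/-- **`#TableauPair n = n!`**: the same-shape pairs of standard Young tableaux with `n` cells number
`∑_{μ ⊢ n} (f^μ)² = n!` (Frobenius–Young / Robinson–Schensted; tree: `sum_sq_numStandardTableaux`). [folklore] -/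
theorem card_tableauPair : ∀ n : ℕ, Nat.card (TableauPair n) = n.factorial := by
  intro n
  classical
  rw [← Literature.RepresentationTheory.FiniteGroups.sum_sq_numStandardTableaux n, Nat.card_eq_fintype_card]
  unfold TableauPair
  rw [Fintype.card_sigma]
  refine Finset.sum_congr rfl fun μ _ => ?_
  rw [Fintype.card_prod, sq, numStandardTableaux_eq_card_stdFilling, Nat.card_eq_fintype_card]

end Summit.MatrixMultiplication.MatrixMultiplication.Theorems
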